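import Mathlib
import Summits.NavierStokesRegularity.NavierStokesRegularity.Theorems.FilamentSkeletonRssStadiumKernelPieces

/-!
# Route `FilamentSkeletonRss` · cruxes `SkeletonJ1L` (stmt-NavierStokesRegularity-23296, registered stub `stub_tangentSkeletonL` ≡
# `TangentSkeletonNearStraightL`, stmt-23320) · line `child_tangent_analytic_strip_L` (b0b56c52900dd90a), stub `stub_stripPropagation` —
# brick for `rcore`: THE REAL-SOURCE KERNEL IS CONTINUOUS AND INTEGRABLE ON A CERTIFIED SOURCE SET

The tent freeze (`Theorems.StadiumTentFreezeNhds.tent_eq_frozen_nhds_sharp`) asks for INTEGRABILITY of the real-source (foot) kernel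
`g_z σ = ((Σᵢ (Fᵢ z − Xᵢ σ)² + κ A σ)^{3/2})⁻¹ • (X′ σ ⨯₃ (F z − X σ))` of a fixed target `z` on the feet `Iic (ℓ z₀)`, `Iic (ℓ z)`, `Ioi (r z₀)`,
`Ioi (r z)`.  The dominated-holomorphy brick `Theorems.StadiumFarPieceHolomorphic.differentiableOn_farPiece` proves the needed continuity internally but
does not export it.  Here, for ONE target and a source set `T` on which the principal-branch condition `0 < Re(base)` holds:
* `realKernel_continuousOn` — `σ ↦ g_z σ` is continuous on `T` (`X ∈ C¹`, `A` continuous, `(w^{3/2})⁻¹` continuous on `Re w > 0`);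
* `realKernel_integrableOn_of_bound` — with a measurable `T`, an integrable majorant on `T` it is integrable on `T`;
* `realKernel_integrableOn_Icc` — on a compact interval positivity alone suffices.
So the feet integrability follows from the margins of `Theorems.StadiumFrozenRealPiece` (compact parts) and the Lorentzian majorants of
`Theorems.StadiumQuarterFootTail(Left)` (tails).
HONEST FRAMING: a brick for the bookkeeping of a HYPOTHETICAL filament skeleton on the NEGATIVE side of a MODEL route; the stub `stub_stripPropagation`
is NOT closed by this file, `TangentSkeletonNearStraightL` / `SkeletonJ1L` stay OPEN; nothing here bears on Navier–Stokes regularity or blow-up.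
`--supports stmt-NavierStokesRegularity-23320` (≡ stub `stub_tangentSkeletonL` of 23296).
-/

set_option linter.dupNamespace false

noncomputable section

namespace Summit.NavierStokesRegularity.NavierStokesRegularity.Theorems.StadiumRealKernelIntegrable

open Set Filter Topology Complex MeasureTheory
open scoped Matrix
open Summit.NavierStokesRegularity.NavierStokesRegularity.Theorems.StadiumKernelPieces

/-- **The real-source kernel of a fixed target is continuous on a certified source set.**  `X ∈ C¹`, `A` continuous, and
`0 < Re(Σᵢ (Fᵢ z − Xᵢ σ)² + κ A σ)` for `σ ∈ T`. [folklore] -/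
theorem realKernel_continuousOn {F : ℂ → (Fin 3 → ℂ)} {X : ℝ → EuclideanSpace ℝ (Fin 3)} (hX : ContDiff ℝ 1 X)
    {A : ℝ → ℝ} (hA : Continuous A) {κ : ℝ} (z : ℂ) {T : Set ℝ}
    (hpos : ∀ σ ∈ T, 0 < ((∑ i, (F z i - ((X σ i : ℝ) : ℂ)) ^ 2) + ((κ * A σ : ℝ) : ℂ)).re) :
    ContinuousOn (fun σ => (((∑ i, (F z i - ((X σ i : ℝ) : ℂ)) ^ 2) + ((κ * A σ : ℝ) : ℂ)) ^ ((3:ℂ) / 2))⁻¹ •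
      ((fun i => ((deriv X σ i : ℝ) : ℂ)) ⨯₃ (fun i => F z i - ((X σ i : ℝ) : ℂ)))) T := by
  have hXc : Continuous X := hX.continuous
  have hdXc : Continuous (deriv X) := hX.continuous_deriv le_rfl
  have hofLp : Continuous (@WithLp.ofLp 2 (Fin 3 → ℝ)) := PiLp.continuous_ofLp 2 (fun _ : Fin 3 => ℝ)
  have hXo : Continuous fun σ => WithLp.ofLp (X σ) := hofLp.comp hXc
  have hdXo : Continuous fun σ => WithLp.ofLp (deriv X σ) := hofLp.comp hdXc
  have hXi : ∀ i, Continuous fun σ => ((X σ i : ℝ) : ℂ) := fun i =>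
    Complex.continuous_ofReal.comp ((continuous_apply i).comp hXo)
  have hdXi : ∀ i, Continuous fun σ => ((deriv X σ i : ℝ) : ℂ) := fun i =>
    Complex.continuous_ofReal.comp ((continuous_apply i).comp hdXo)
  have hW : Continuous fun σ => (∑ i, (F z i - ((X σ i : ℝ) : ℂ)) ^ 2) + ((κ * A σ : ℝ) : ℂ) := by
    have h1 : ∀ i, Continuous fun σ => (F z i - ((X σ i : ℝ) : ℂ)) ^ 2 := fun i => (continuous_const.sub (hXi i)).pow 2
    exact (continuous_finsetSum _ fun i _ => h1 i).add (Complex.continuous_ofReal.comp (continuous_const.mul hA))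
  have hN : Continuous fun σ => (fun i => ((deriv X σ i : ℝ) : ℂ)) ⨯₃ (fun i => F z i - ((X σ i : ℝ) : ℂ)) := by
    have hai : ∀ i, Continuous fun σ => ((deriv X σ i : ℝ) : ℂ) := hdXi
    have hbi : ∀ i, Continuous fun σ => F z i - ((X σ i : ℝ) : ℂ) := fun i => continuous_const.sub (hXi i)
    refine continuous_pi fun i => ?_
    fin_cases i
    · simpa [cross_apply, Pi.mul_def, Pi.sub_def] using ((hai 1).mul (hbi 2)).sub ((hai 2).mul (hbi 1))
    · simpa [cross_apply, Pi.mul_def, Pi.sub_def] using ((hai 2).mul (hbi 0)).sub ((hai 0).mul (hbi 2))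
    · simpa [cross_apply, Pi.mul_def, Pi.sub_def] using ((hai 0).mul (hbi 1)).sub ((hai 1).mul (hbi 0))
  intro σ hσ
  have hc : ContinuousAt (fun w : ℂ => (w ^ ((3:ℂ) / 2))⁻¹) ((∑ i, (F z i - ((X σ i : ℝ) : ℂ)) ^ 2) + ((κ * A σ : ℝ) : ℂ)) :=
    (differentiableAt_inv_cpow_threeHalves (hpos σ hσ)).continuousAt
  exact (ContinuousAt.comp_continuousWithinAt
    (f := fun σ => (∑ i, (F z i - ((X σ i : ℝ) : ℂ)) ^ 2) + ((κ * A σ : ℝ) : ℂ)) hc hW.continuousWithinAt).smul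
    hN.continuousWithinAt

/-- **… hence integrable on a measurable certified source set under an integrable majorant.** [folklore] -/
theorem realKernel_integrableOn_of_bound {F : ℂ → (Fin 3 → ℂ)} {X : ℝ → EuclideanSpace ℝ (Fin 3)} (hX : ContDiff ℝ 1 X)
    {A : ℝ → ℝ} (hA : Continuous A) {κ : ℝ} (z : ℂ) {T : Set ℝ} (hT : MeasurableSet T)
    (hpos : ∀ σ ∈ T, 0 < ((∑ i, (F z i - ((X σ i : ℝ) : ℂ)) ^ 2) + ((κ * A σ : ℝ) : ℂ)).re)
    {bound : ℝ → ℝ} (hbound : IntegrableOn bound T)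
    (hdom : ∀ σ ∈ T, ‖(((∑ i, (F z i - ((X σ i : ℝ) : ℂ)) ^ 2) + ((κ * A σ : ℝ) : ℂ)) ^ ((3:ℂ) / 2))⁻¹ •
      ((fun i => ((deriv X σ i : ℝ) : ℂ)) ⨯₃ (fun i => F z i - ((X σ i : ℝ) : ℂ)))‖ ≤ bound σ) :
    IntegrableOn (fun σ => (((∑ i, (F z i - ((X σ i : ℝ) : ℂ)) ^ 2) + ((κ * A σ : ℝ) : ℂ)) ^ ((3:ℂ) / 2))⁻¹ •
      ((fun i => ((deriv X σ i : ℝ) : ℂ)) ⨯₃ (fun i => F z i - ((X σ i : ℝ) : ℂ)))) T := by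
  refine Integrable.mono' hbound ((realKernel_continuousOn hX hA z hpos).aestronglyMeasurable hT) ?_
  exact ae_restrict_of_forall_mem hT fun σ hσ => hdom σ hσ

/-- **… and integrable on a compact interval from positivity alone.** [folklore] -/
theorem realKernel_integrableOn_Icc {F : ℂ → (Fin 3 → ℂ)} {X : ℝ → EuclideanSpace ℝ (Fin 3)} (hX : ContDiff ℝ 1 X)
    {A : ℝ → ℝ} (hA : Continuous A) {κ : ℝ} (z : ℂ) {a b : ℝ}
    (hpos : ∀ σ ∈ Icc a b, 0 < ((∑ i, (F z i - ((X σ i : ℝ) : ℂ)) ^ 2) + ((κ * A σ : ℝ) : ℂ)).re) :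
    IntegrableOn (fun σ => (((∑ i, (F z i - ((X σ i : ℝ) : ℂ)) ^ 2) + ((κ * A σ : ℝ) : ℂ)) ^ ((3:ℂ) / 2))⁻¹ •
      ((fun i => ((deriv X σ i : ℝ) : ℂ)) ⨯₃ (fun i => F z i - ((X σ i : ℝ) : ℂ)))) (Icc a b) :=
  (realKernel_continuousOn hX hA z hpos).integrableOn_compact isCompact_Icc

end Summit.NavierStokesRegularity.NavierStokesRegularity.Theorems.StadiumRealKernelIntegrable

end
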